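import Literature.NumberTheory.Transcendental.KZVolumeConjecture
import Literature.NumberTheory.Transcendental.KZGroundingRelations
import Literature.NumberTheory.Transcendental.KZMonomialCompression
import HarnessLib

/-!
# Conjecture 1 ⇔ its volume form, from the semi-canonical reduction (Cresson–Viu-Sos 2022, §1)

Proof file for the named fact `KZ.kzPeriodConjecture'_iff_volumeConjectureCompact` of
`KZVolumeConjecture.lean` (`KZPeriodConjecture' ↔ volumeConjectureCompact`: Conjecture 1 of
[Kontsevich–Zagier 2001, §1.2] in its two-representation form is equivalent to its *volume form*
"volume is the only KZ-invariant of compact top-dimensional semialgebraic sets"). Theorems only: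
no definition and no named fact is introduced.

Source read: J. Cresson, J. Viu-Sos, *On the equality of periods of Kontsevich–Zagier*, J. Théor.
Nombres Bordeaux 34 (2022) 323–343 (`lit read 10.5802/jtnb.1204`, materialised pp. 4–5 = printed
pp. 325–326). [Cresson–Viu-Sos 2022, §1, pp. 325–326] deduce the equivalence "Conjecture 1 ⇔ volume form" from
Viu-Sos' semi-canonical reduction [Viu-Sos 2021, Thm. 1.1] in two lines: "`I(S, ω) ∼ I(K, 1)` and
`I(S̃, ω̃) ∼ I(K̃, 1)`, so that (1.2) implies `I(K, 1) ∼ I(K̃, 1)`". Below this deduction is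
carried out over the calculus of `KZCalculus.lean`, with the semi-canonical reduction as the
explicit hypothesis `(hs : semiCanonicalReduction)` (the named fact of this file, Viu-Sos'
Thm. 1.1, whose printed proof is a compactification by projective charts followed by Hironaka's
embedded resolution of singularities and is not formalised in the tree). Three points the print
passes over are handled explicitly:

* the sign `sgn(p)` and the *zero periods* (to which Thm. 1.1 does not apply): every
  representation `r` is written `[r] ≡ [A] − [B]` modulo moves with `A`, `B` *volume
  representations* (compact domain with non-empty interior, integrand `1` on it) of one
  dimension — for `p = 0` one glues a point of volume `1` to `r` first
  (`IntegralRep.exists_of_add_of_sub_of_mem_relations`), passes to a representation of KZ's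
  literal shape (`exists_isRational_equivalent`) and only then reduces;
* the two compact sets `K ⊂ ℝ^m`, `K̃ ⊂ ℝ^{m̃}` produced by Thm. 1.1 need not lie in the same
  dimension, whereas the volume conjecture compares sets in one `ℝ^d`: volume representations are
  raised to any higher dimension by unit slabs `K × [0, 1]` (one Newton–Leibniz move each,
  `IntegralRep.slab`), which stay compact, top-dimensional and of integrand `1`;
* sums `[A] + [B']` of volume representations are single volume representations (disjoint slabs
  at levels `[0, 1]` and `[2, 3]`, glued by domain additivity), so that from
  `vol A + vol B' = vol A' + vol B` the volume conjecture gives `[A] + [B'] ≡ [A'] + [B]`.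

## Main statements

* `KZ.IntegralRep.isCompact_slabDomain`, `KZ.IntegralRep.interior_slabDomain_nonempty`,
  `KZ.IntegralRep.exists_volumeRep_equivalent_of_le`,
  `KZ.IntegralRep.exists_volumeRep_of_add_sub_of_mem_relations` — volume representations are
  stable under unit slabs, raising the dimension, and (disjoint) sums, modulo the moves;
* `KZ.IntegralRep.exists_sub_volumeRep_mem_relations_of_semiCanonicalReduction` — given
  Thm. 1.1, every representation is `≡ [A] − [B]` with `A`, `B` volume representations of one
  dimension;
* `KZ.kzPeriodConjecture'_of_volumeConjectureCompact` — `semiCanonicalReduction →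
  volumeConjectureCompact → KZPeriodConjecture'`;
* `KZ.kzPeriodConjecture'_iff_volumeConjectureCompact_of_semiCanonicalReduction` — the named fact
  from `semiCanonicalReduction`, in one line (the converse direction being
  `volumeConjectureCompact_of_kzPeriodConjecture'` of `KZVolumeConjecture.lean`).

## Discharges (appended)

* `KZ.semiCanonicalReduction_holds` — **[Viu-Sos 2021, Thm. 1.1] discharged** over the calculus:
  steps (c) (sign split, region under the graph) and (d) (difference of two volumes by cube
  counting, §4) of the printed proof as in `KZSemiCanonicalReductionProofs.lean`, with the printed
  step (b) (separation of poles by Hironaka's embedded resolution, Prop. 2.2 / Cor. 2.2) REPLACED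
  by a resolution-free argument: grounding inside the calculus (`KZGroundingRelations.lean`),
  polynomial box decay of finite-volume down-sets (`DownSetTailDecay.lean`) and a monomial change
  of variables with constant Jacobian (`KZMonomialCompression.lean`); see the section
  "Discharge of the semi-canonical reduction" at the end of the file;
* `KZ.kzPeriodConjecture'_iff_volumeConjectureCompact_holds` — the named fact of this file, by
  `kzPeriodConjecture'_iff_volumeConjectureCompact_of_semiCanonicalReduction`.

## References

* J. Cresson, J. Viu-Sos, *On the equality of periods of Kontsevich–Zagier*, J. Théor. Nombres
  Bordeaux 34 (2022) 323–343, §1 (pp. 325–326).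
* J. Viu-Sos, *A semi-canonical reduction for periods of Kontsevich–Zagier*, Int. J. Number
  Theory 17 (2021) 147–174, Thm. 1.1 (arXiv:1509.01097).
* M. Kontsevich, D. Zagier, *Periods*, in: Mathematics Unlimited — 2001 and Beyond, Springer
  (2001), §1.2, Conjecture 1 and rules (1)–(3).
-/

noncomputable section

namespace Literature.NumberTheory.Transcendental

namespace KZ

open _root_.MeasureTheory _root_.Set
open Literature.ModelTheory.ExponentialFields

variable {n d : ℕ}

/-- Relations evaluate to `0` (soundness, `relations_le_ker_eval_holds`), as an equation.
[Kontsevich–Zagier 2001, §1.2] [cite: KontsevichZagier2001, §1.2] -/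
theorem eval_eq_zero_of_mem_relations {c : FormalRep} (h : c ∈ relations) : eval c = 0 :=
  relations_le_ker_eval_holds h

namespace IntegralRep

/-! #### Volume representations are stable under slabs, raising the dimension, and gluing -/

/-- The unit slab `σ × [j, j + 1]` over a compact domain `σ` is compact: it is the image of
`σ × [j, j + 1]` under the continuous map `(x, t) ↦ (x, t) = Fin.snoc x t`.
[Kontsevich–Zagier 2001, §1.2] [cite: KontsevichZagier2001, §1.2] -/
theorem isCompact_slabDomain (r : IntegralRep n) (j : ℕ) (hc : IsCompact r.domain) :
    IsCompact (r.slabDomain j) := by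
  have hcont : Continuous fun p : (Fin n → ℝ) × ℝ => (Fin.snoc p.1 p.2 : Fin (n + 1) → ℝ) :=
    Continuous.finSnoc (A := fun _ : Fin (n + 1) => ℝ) continuous_fst continuous_snd
  have himage : (fun p : (Fin n → ℝ) × ℝ => (Fin.snoc p.1 p.2 : Fin (n + 1) → ℝ)) ''
      (r.domain ×ˢ Icc (j : ℝ) (j + 1)) = r.slabDomain j := by
    ext z
    simp only [mem_image, mem_prod, Prod.exists]
    constructor
    · rintro ⟨x, t, ⟨hx, ht⟩, rfl⟩
      exact (r.snoc_mem_slabDomain j).2 ⟨hx, ht⟩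
    · intro hz
      simp only [slabDomain, mem_setOf_eq] at hz
      exact ⟨Fin.init z, z (Fin.last n), ⟨hz.1, hz.2.1, hz.2.2⟩, Fin.snoc_init_self z⟩
  rw [← himage]
  exact (hc.prod isCompact_Icc).image hcont

/-- The unit slab over a domain with non-empty interior has non-empty interior: over an interior
point `x` of `σ`, the point `(x, j + 1/2)` lies in the open box
`init⁻¹(interior σ) ∩ {j < t < j + 1} ⊆ σ × [j, j + 1]`.
[Kontsevich–Zagier 2001, §1.2] [cite: KontsevichZagier2001, §1.2] -/
theorem interior_slabDomain_nonempty (r : IntegralRep n) (j : ℕ)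
    (hi : (interior r.domain).Nonempty) : (interior (r.slabDomain j)).Nonempty := by
  obtain ⟨x, hx⟩ := hi
  have hinit : Continuous fun z : Fin (n + 1) → ℝ => (Fin.init z : Fin n → ℝ) :=
    continuous_id.finInit
  refine ⟨Fin.snoc x ((j : ℝ) + 1 / 2), ?_⟩
  rw [mem_interior]
  refine ⟨((fun z : Fin (n + 1) → ℝ => (Fin.init z : Fin n → ℝ)) ⁻¹' interior r.domain) ∩
      {z | (j : ℝ) < z (Fin.last n)} ∩ {z | z (Fin.last n) < j + 1}, ?_, ?_, ?_⟩
  · rintro z ⟨⟨h₁, h₂⟩, h₃⟩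
    simp only [mem_preimage] at h₁
    simp only [slabDomain, mem_setOf_eq]
    exact ⟨interior_subset h₁, le_of_lt h₂, le_of_lt h₃⟩
  · exact ((isOpen_interior.preimage hinit).inter
      (isOpen_lt continuous_const (continuous_apply _))).inter
      (isOpen_lt (continuous_apply _) continuous_const)
  · refine ⟨⟨?_, ?_⟩, ?_⟩
    · simpa only [mem_preimage, Fin.init_snoc] using hx
    · simp only [mem_setOf_eq, Fin.snoc_last]
      linarith
    · simp only [mem_setOf_eq, Fin.snoc_last]
      linarith

/-- The slab of a representation with integrand `1` on its domain has integrand `1` on its domain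
(the slab integrand is `(x, t) ↦ f x`). [Kontsevich–Zagier 2001, §1.2] [cite: KontsevichZagier2001, §1.2] -/
theorem slab_integrand_eq_one (r : IntegralRep n) (j : ℕ) (h1 : ∀ x ∈ r.domain, r.integrand x = 1) :
    ∀ z ∈ (r.slab j).domain, (r.slab j).integrand z = 1 := by
  intro z hz
  simp only [domain_slab, slabDomain, mem_setOf_eq] at hz
  exact h1 _ hz.1

/-- **Raising the dimension of a volume representation.** A representation with compact domain
of non-empty interior and integrand `1` is equivalent, for every `e`, to such a representation in
dimension `d + e` (iterate the unit slab `K × [0, 1]`, one Newton–Leibniz move each).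
[Cresson–Viu-Sos 2022, §1 p. 326; Kontsevich–Zagier 2001, §1.2] [cite: CressonViusos2022, §1 p. 326] -/
theorem exists_volumeRep_equivalent_add (K : IntegralRep d) (hc : IsCompact K.domain)
    (hi : (interior K.domain).Nonempty) (h1 : ∀ x ∈ K.domain, K.integrand x = 1) :
    ∀ e : ℕ, ∃ K' : IntegralRep (d + e), IsCompact K'.domain ∧ (interior K'.domain).Nonempty ∧
      (∀ x ∈ K'.domain, K'.integrand x = 1) ∧ Equivalent K K'
  | 0 => ⟨K, hc, hi, h1, Equivalent.refl K⟩
  | e + 1 => by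
    obtain ⟨K', hc', hi', h1', hE⟩ := exists_volumeRep_equivalent_add K hc hi h1 e
    exact ⟨K'.slab 0, K'.isCompact_slabDomain 0 hc', K'.interior_slabDomain_nonempty 0 hi',
      K'.slab_integrand_eq_one 0 h1', hE.trans (K'.equivalent_slab 0)⟩

/-- A volume representation is equivalent to a volume representation in any dimension `N ≥ d`.
[Cresson–Viu-Sos 2022, §1 p. 326; Kontsevich–Zagier 2001, §1.2] [cite: CressonViusos2022, §1 p. 326] -/
theorem exists_volumeRep_equivalent_of_le (K : IntegralRep d) (hc : IsCompact K.domain)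
    (hi : (interior K.domain).Nonempty) (h1 : ∀ x ∈ K.domain, K.integrand x = 1) {N : ℕ}
    (h : d ≤ N) :
    ∃ K' : IntegralRep N, IsCompact K'.domain ∧ (interior K'.domain).Nonempty ∧
      (∀ x ∈ K'.domain, K'.integrand x = 1) ∧ Equivalent K K' := by
  obtain ⟨e, rfl⟩ := Nat.exists_eq_add_of_le h
  exact K.exists_volumeRep_equivalent_add hc hi h1 e

/-- **Adding two volume representations.** For two representations `A`, `B` of one dimension with
compact domains of non-empty interior and integrand `1`, the glued representation
`M = (A × [0, 1]) ⊔ (B × [2, 3])` is again of this kind and `[A] + [B] − [M] ∈ relations`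
(two Newton–Leibniz moves and one domain-additivity move).
[Cresson–Viu-Sos 2022, §1 p. 326; Kontsevich–Zagier 2001, §1.2] [cite: CressonViusos2022, §1 p. 326] -/
theorem exists_volumeRep_of_add_sub_of_mem_relations (A B : IntegralRep d)
    (hAc : IsCompact A.domain) (hAi : (interior A.domain).Nonempty)
    (hA1 : ∀ x ∈ A.domain, A.integrand x = 1) (hBc : IsCompact B.domain)
    (hB1 : ∀ x ∈ B.domain, B.integrand x = 1) :
    ∃ M : IntegralRep (d + 1), IsCompact M.domain ∧ (interior M.domain).Nonempty ∧
      (∀ x ∈ M.domain, M.integrand x = 1) ∧ of A + of B - of M ∈ relations := by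
  have hd := disjoint_domain_slab_zero_two A B
  refine ⟨(A.slab 0).glue (B.slab 2) hd, ?_, ?_, ?_, ?_⟩
  · exact (A.isCompact_slabDomain 0 hAc).union (B.isCompact_slabDomain 2 hBc)
  · exact (A.interior_slabDomain_nonempty 0 hAi).mono (interior_mono subset_union_left)
  · intro z hz
    rw [domain_glue, mem_union] at hz
    rcases hz with hz | hz
    · rw [eqOn_integrand_glue_left _ _ hd hz]
      exact A.slab_integrand_eq_one 0 hA1 z hz
    · rw [eqOn_integrand_glue_right _ _ hd hz]
      exact B.slab_integrand_eq_one 2 hB1 z hz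
  · have hglue := domainAddRel_subset_relations (of_glue_sub_sub_mem_domainAddRel _ _ hd)
    have : of A + of B - of ((A.slab 0).glue (B.slab 2) hd) =
        (of A - of (A.slab 0)) + (of B - of (B.slab 2)) -
          (of ((A.slab 0).glue (B.slab 2) hd) - of (A.slab 0) - of (B.slab 2)) := by
      abel
    rw [this]
    exact relations.sub_mem (relations.add_mem (A.equivalent_slab 0) (B.equivalent_slab 2)) hglue

/-- **A volume representation exists** — the point: dimension `0`, domain `ℝ⁰ = {pt}` (compact,
open), integrand `1`; its value is `vol₀(pt) = 1`. [Kontsevich–Zagier 2001, §1.1–1.2 (constants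
are periods)] [cite: KontsevichZagier2001, §1.2] -/
theorem exists_volumeRep_zero : ∃ C : IntegralRep 0, IsCompact C.domain ∧
    (interior C.domain).Nonempty ∧ ∀ x ∈ C.domain, C.integrand x = 1 := by
  have hc : IsCompact (univ : Set (Fin 0 → ℝ)) := subsingleton_univ.isCompact
  refine ⟨⟨univ, fun _ => 1, isSemialgebraic_univ, ?_, ?_⟩, hc, ?_, fun _ _ => rfl⟩
  · simpa using isSemialgebraicFunOn_aeval
      (isSemialgebraic_univ : IsSemialgebraic ℚ (univ : Set (Fin 0 → ℝ)))
      (1 : MvPolynomial (Fin 0) ℚ)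
  · exact integrableOn_const (hs := hc.measure_lt_top.ne)
  · rw [interior_univ]
    exact univ_nonempty

/-- A representation with compact domain of non-empty interior and integrand `1` has positive
value `vol(K) > 0` (Lebesgue measure is positive on non-empty open sets and finite on compact
sets). [folklore] -/
theorem value_pos_of_integrand_eq_one (K : IntegralRep d) (hc : IsCompact K.domain)
    (hi : (interior K.domain).Nonempty) (h1 : ∀ x ∈ K.domain, K.integrand x = 1) :
    0 < K.value := by
  have hEq : EqOn K.integrand (fun _ => (1 : ℝ)) K.domain := fun x hx => h1 x hx
  rw [value, setIntegral_congr_fun (measurableSet_domain_holds K) hEq, setIntegral_const,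
    smul_eq_mul, mul_one, measureReal_def]
  exact ENNReal.toReal_pos (Measure.measure_pos_of_nonempty_interior volume hi).ne'
    hc.measure_lt_top.ne

/-- **Every representation is a difference of two volume representations modulo moves**
(from the semi-canonical reduction). Given Viu-Sos' Thm. 1.1 (`semiCanonicalReduction`), for every
integral representation `r` there are representations `A`, `B` of one dimension, with compact
domains of non-empty interior and integrand `1`, such that `[r] − ([A] − [B]) ∈ relations`:
pass to an equivalent representation `R` of KZ's literal shape (`exists_isRational_equivalent`);
if `p = value r > 0`, Thm. 1.1 gives `[R] ≡ [K]` and `[r] ≡ ([K] + [C]) − [C]`; if `p < 0`,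
`[R] ≡ −[K]` and `[r] ≡ [C] − ([K] + [C])`; if `p = 0`, glue the point `C` (value `1`) to `r`
first, so that Thm. 1.1 applies to (a literal-shape equivalent of) `[r] + [C]`, giving
`[r] ≡ [K] − [C]`. Here `C` is the point of `exists_volumeRep_zero`, raised to the dimension at
hand by unit slabs. [Cresson–Viu-Sos 2022, §1 pp. 325–326] [cite: CressonViusos2022, §1 p. 326] -/
theorem exists_sub_volumeRep_mem_relations_of_semiCanonicalReduction
    (hs : semiCanonicalReduction) (r : IntegralRep n) :
    ∃ (D : ℕ) (A B : IntegralRep D),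
      (IsCompact A.domain ∧ (interior A.domain).Nonempty ∧ ∀ x ∈ A.domain, A.integrand x = 1) ∧
      (IsCompact B.domain ∧ (interior B.domain).Nonempty ∧ ∀ x ∈ B.domain, B.integrand x = 1) ∧
      of r - (of A - of B) ∈ relations := by
  obtain ⟨C, hCc, hCi, hC1⟩ := exists_volumeRep_zero
  have hCpos : 0 < C.value := C.value_pos_of_integrand_eq_one hCc hCi hC1
  rcases lt_trichotomy r.value 0 with hneg | hzero | hpos
  · -- `p < 0`: `[r] ≡ [R] ≡ −[K] ≡ [C''] − [M]` with `[M] ≡ [K] + [C']`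
    obtain ⟨m, R, hR, hrR⟩ := exists_isRational_equivalent_holds r
    have hRv : R.value = r.value := (Equivalent.value_eq_holds hrR).symm
    obtain ⟨k, K, -, -, hKc, hKi, hK1, -, hKneg⟩ := hs R hR (by rw [hRv]; exact hneg.ne)
    have hRK : of R + of K ∈ relations := hKneg (by rw [hRv]; exact hneg)
    obtain ⟨C', hC'c, hC'i, hC'1, -⟩ :=
      C.exists_volumeRep_equivalent_of_le hCc hCi hC1 (Nat.zero_le k)
    obtain ⟨M, hMc, hMi, hM1, hM⟩ :=
      K.exists_volumeRep_of_add_sub_of_mem_relations C' hKc hKi hK1 hC'c hC'1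
    obtain ⟨C'', hC''c, hC''i, hC''1, hC'C''⟩ :=
      C'.exists_volumeRep_equivalent_of_le hC'c hC'i hC'1 (Nat.le_succ k)
    refine ⟨k + 1, C'', M, ⟨hC''c, hC''i, hC''1⟩, ⟨hMc, hMi, hM1⟩, ?_⟩
    have : of r - (of C'' - of M) =
        (of r - of R) + (of R + of K) - (of K + of C' - of M) + (of C' - of C'') := by
      abel
    rw [this]
    exact relations.add_mem (relations.sub_mem (relations.add_mem hrR hRK) hM) hC'C''
  · -- `p = 0`: glue the point first, `[r] + [C] ≡ [R₀] ≡ [R] ≡ [K]`, so `[r] ≡ [K] − [C']`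
    obtain ⟨N, R₀, hR₀⟩ := r.exists_of_add_of_sub_of_mem_relations C
    obtain ⟨m, R, hR, hR₀R⟩ := exists_isRational_equivalent_holds R₀
    have hRv : R.value = C.value := by
      have h0 := eval_eq_zero_of_mem_relations hR₀
      simp only [map_sub, map_add, eval_of, hzero, zero_add] at h0
      rw [← Equivalent.value_eq_holds hR₀R]
      linarith
    obtain ⟨k, K, -, -, hKc, hKi, hK1, hKpos, -⟩ := hs R hR (by rw [hRv]; exact hCpos.ne')
    have hRK : of R - of K ∈ relations := hKpos (by rw [hRv]; exact hCpos)
    obtain ⟨C', hC'c, hC'i, hC'1, hCC'⟩ :=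
      C.exists_volumeRep_equivalent_of_le hCc hCi hC1 (Nat.zero_le k)
    refine ⟨k, K, C', ⟨hKc, hKi, hK1⟩, ⟨hC'c, hC'i, hC'1⟩, ?_⟩
    have : of r - (of K - of C') =
        (of r + of C - of R₀) + (of R₀ - of R) + (of R - of K) - (of C - of C') := by
      abel
    rw [this]
    exact relations.sub_mem (relations.add_mem (relations.add_mem hR₀ hR₀R) hRK) hCC'
  · -- `p > 0`: `[r] ≡ [R] ≡ [K] ≡ [M] − [C'']` with `[M] ≡ [K] + [C']`
    obtain ⟨m, R, hR, hrR⟩ := exists_isRational_equivalent_holds r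
    have hRv : R.value = r.value := (Equivalent.value_eq_holds hrR).symm
    obtain ⟨k, K, -, -, hKc, hKi, hK1, hKpos, -⟩ := hs R hR (by rw [hRv]; exact hpos.ne')
    have hRK : of R - of K ∈ relations := hKpos (by rw [hRv]; exact hpos)
    obtain ⟨C', hC'c, hC'i, hC'1, -⟩ :=
      C.exists_volumeRep_equivalent_of_le hCc hCi hC1 (Nat.zero_le k)
    obtain ⟨M, hMc, hMi, hM1, hM⟩ :=
      K.exists_volumeRep_of_add_sub_of_mem_relations C' hKc hKi hK1 hC'c hC'1
    obtain ⟨C'', hC''c, hC''i, hC''1, hC'C''⟩ :=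
      C'.exists_volumeRep_equivalent_of_le hC'c hC'i hC'1 (Nat.le_succ k)
    refine ⟨k + 1, M, C'', ⟨hMc, hMi, hM1⟩, ⟨hC''c, hC''i, hC''1⟩, ?_⟩
    have : of r - (of M - of C'') =
        (of r - of R) + (of R - of K) + (of K + of C' - of M) - (of C' - of C'') := by
      abel
    rw [this]
    exact relations.sub_mem (relations.add_mem (relations.add_mem hrR hRK) hM) hC'C''

end IntegralRep

/-- **The volume form implies Conjecture 1, given the semi-canonical reduction**
[Cresson–Viu-Sos 2022, §1, pp. 325–326: "By the semi-canonical reduction theorem above, we have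
`I(S, ω) ∼ I(K, 1)` and `I(S̃, ω̃) ∼ I(K̃, 1)`, so that the equivalence relation (1.2) implies
`I(K, 1) ∼ I(K̃, 1)`. As a consequence, the Kontsevich–Zagier conjecture is equivalent to" the
volume conjecture]. Proof over the calculus: write `[r] ≡ [A] − [B]`, `[r'] ≡ [A'] − [B']` with
volume representations (`IntegralRep.exists_sub_volumeRep_mem_relations_of_semiCanonicalReduction`),
raise all four to one dimension, glue `M₁ ≡ [A] + [B']`, `M₂ ≡ [A'] + [B]`; by soundness
`vol M₁ = value r + vol B + vol B' = value r' + vol B' + vol B = vol M₂`, so the volume conjecture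
gives `[M₁] ≡ [M₂]`, whence `[r] ≡ [r']`. The hypothesis `hs` is Viu-Sos' Thm. 1.1
(`semiCanonicalReduction`). [cite: CressonViusos2022, §1 p. 326] -/
theorem kzPeriodConjecture'_of_volumeConjectureCompact (hs : semiCanonicalReduction)
    (hv : volumeConjectureCompact) : KZPeriodConjecture' := by
  intro n m r r' hval
  obtain ⟨D, A, B, ⟨hAc, hAi, hA1⟩, ⟨hBc, hBi, hB1⟩, hrAB⟩ :=
    IntegralRep.exists_sub_volumeRep_mem_relations_of_semiCanonicalReduction hs r
  obtain ⟨D', A', B', ⟨hA'c, hA'i, hA'1⟩, ⟨hB'c, hB'i, hB'1⟩, hr'AB⟩ :=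
    IntegralRep.exists_sub_volumeRep_mem_relations_of_semiCanonicalReduction hs r'
  -- raise the four volume representations to the common dimension `max D D'`
  obtain ⟨A₁, hA₁c, hA₁i, hA₁1, hAA₁⟩ :=
    A.exists_volumeRep_equivalent_of_le hAc hAi hA1 (le_max_left D D')
  obtain ⟨B₁, hB₁c, hB₁i, hB₁1, hBB₁⟩ :=
    B.exists_volumeRep_equivalent_of_le hBc hBi hB1 (le_max_left D D')
  obtain ⟨A₁', hA₁'c, hA₁'i, hA₁'1, hAA₁'⟩ :=
    A'.exists_volumeRep_equivalent_of_le hA'c hA'i hA'1 (le_max_right D D')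
  obtain ⟨B₁', hB₁'c, hB₁'i, hB₁'1, hBB₁'⟩ :=
    B'.exists_volumeRep_equivalent_of_le hB'c hB'i hB'1 (le_max_right D D')
  -- glue `A₁ ⊔ B₁'` and `A₁' ⊔ B₁`
  obtain ⟨M₁, hM₁c, hM₁i, hM₁1, hM₁⟩ :=
    A₁.exists_volumeRep_of_add_sub_of_mem_relations B₁' hA₁c hA₁i hA₁1 hB₁'c hB₁'1
  obtain ⟨M₂, hM₂c, hM₂i, hM₂1, hM₂⟩ :=
    A₁'.exists_volumeRep_of_add_sub_of_mem_relations B₁ hA₁'c hA₁'i hA₁'1 hB₁c hB₁1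
  -- the two glued sets have the same volume (soundness of the moves)
  have hvol : M₁.value = M₂.value := by
    have e₁ := eval_eq_zero_of_mem_relations hrAB
    have e₂ := eval_eq_zero_of_mem_relations hr'AB
    have e₃ := eval_eq_zero_of_mem_relations hM₁
    have e₄ := eval_eq_zero_of_mem_relations hM₂
    simp only [map_sub, map_add, eval_of] at e₁ e₂ e₃ e₄
    have f₁ := Equivalent.value_eq_holds hAA₁
    have f₂ := Equivalent.value_eq_holds hBB₁
    have f₃ := Equivalent.value_eq_holds hAA₁'
    have f₄ := Equivalent.value_eq_holds hBB₁'
    linarith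
  -- the volume conjecture, and bookkeeping in the formal group
  have hM : of M₁ - of M₂ ∈ relations := hv M₁ M₂ hM₁c hM₁i hM₂c hM₂i hM₁1 hM₂1 hvol
  have : of r - of r' = (of r - (of A - of B)) - (of r' - (of A' - of B'))
      + (of A - of A₁) - (of B - of B₁) - (of A' - of A₁') + (of B' - of B₁')
      + (of A₁ + of B₁' - of M₁) - (of A₁' + of B₁ - of M₂) + (of M₁ - of M₂) := by
    abel
  rw [Equivalent, this]
  refine relations.add_mem (relations.sub_mem (relations.add_mem (relations.add_mem
    (relations.sub_mem (relations.sub_mem (relations.add_mem (relations.sub_mem hrAB hr'AB)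
      hAA₁) hBB₁) hAA₁') hBB₁') hM₁) hM₂) hM

/-- **Conjecture 1 ⇔ its volume form, given the semi-canonical reduction**: the named fact
`kzPeriodConjecture'_iff_volumeConjectureCompact` [Cresson–Viu-Sos 2022, §1, p. 326: "As a
consequence, the Kontsevich–Zagier conjecture is equivalent to: Conjecture …"] follows from
Viu-Sos' semi-canonical reduction `semiCanonicalReduction` [Viu-Sos 2021, Thm. 1.1] exactly as
printed: `→` is the special case `volumeConjectureCompact_of_kzPeriodConjecture'`, `←` is
`kzPeriodConjecture'_of_volumeConjectureCompact`. (The discharge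
`kzPeriodConjecture'_iff_volumeConjectureCompact_holds` is this theorem applied to a discharge of
`semiCanonicalReduction`, whose printed proof — projective compactification and Hironaka's embedded
resolution of singularities [Viu-Sos 2021, §§2.2–2.3] — is not in the tree.)
[cite: CressonViusos2022, §1 p. 326] -/
theorem kzPeriodConjecture'_iff_volumeConjectureCompact_of_semiCanonicalReduction
    (hs : semiCanonicalReduction) : kzPeriodConjecture'_iff_volumeConjectureCompact :=
  ⟨volumeConjectureCompact_of_kzPeriodConjecture', kzPeriodConjecture'_of_volumeConjectureCompact hs⟩


/-! ### Discharge of the semi-canonical reduction [Viu-Sos 2021, Thm. 1.1]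

The printed proof of Thm. 1.1 separates the poles of `P/Q` from the boundary of the (compactified)
domain by Hironaka's embedded resolution of singularities [Viu-Sos 2021, Thm. 2.2, Prop. 2.2,
Cor. 2.2]. The tree replaces this step by a resolution-free argument over the calculus of moves:
the region under the graph of the (sign-split) integrand is a finite-volume `ℚ`-semialgebraic set
one dimension up (`exists_underGraph`, rule (3)); grounding its coordinates one after the other is
a chain of moves and yields a down-set of the open positive orthant
(`KZGroundingRelations.lean`); finite-volume down-sets have polynomially small boxes
(`DownSetTailDecay.lean`) and are therefore compressed onto bounded sets by one monomial change of
variables with constant Jacobian (`KZMonomialCompression.lean`, rule (2)); the difference of the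
two bounded volumes so obtained is one compact top-dimensional volume by the cube-counting
argument of [Viu-Sos 2021, §4] (`exists_isCompact_of_sub_of_sub_mem_relations`, rules (1)–(2)).
Neither the compactification by projective charts [Viu-Sos 2021, Thm. 2.1] nor the rationality
of the integrand is needed on this road. -/

/-- **Finite-volume sets are KZ-equivalent to bounded sets.** A representation of dimension
`m + 1` with integrand `1` (on a `ℚ`-semialgebraic domain of finite volume) differs by relations
from one with integrand `1` on a BOUNDED domain: ground all coordinates
(`exists_downset_sub_mem_relations`) and compress the resulting down-set
(`exists_isBounded_of_downset`). The tree's substitute for [Viu-Sos 2021, Cor. 2.2].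
[cite: ViuSos2021, Thm. 1.1 (step Cor. 2.2, replaced)] -/
theorem exists_isBounded_sub_mem_relations {m : ℕ} (G : IntegralRep (m + 1))
    (h1 : ∀ x ∈ G.domain, G.integrand x = 1) :
    ∃ B : IntegralRep (m + 1), Bornology.IsBounded B.domain ∧ (∀ x ∈ B.domain, B.integrand x = 1) ∧
      of G - of B ∈ relations := by
  obtain ⟨D, hpos, hdown, hD1, eD⟩ := exists_downset_sub_mem_relations G h1
  obtain ⟨B, hBb, hB1, eB⟩ := exists_isBounded_of_downset D hpos hdown hD1
  refine ⟨B, hBb, hB1, ?_⟩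
  have : of G - of B = (of G - of D) + (of D - of B) := by abel
  rw [this]
  exact relations.add_mem eD eB

/-- **Every representation is a difference of two bounded volumes one dimension up, by the
moves**: split the domain by the sign of the integrand (rule (1), Tarski–Seidenberg), flip the
sign on the negative part, take the regions under the graphs (rule (3), `exists_underGraph`) and
make both bounded (`exists_isBounded_sub_mem_relations`). [Viu-Sos 2021, Cor. 2.3 with Cor. 2.2
replaced] [cite: ViuSos2021, Cor. 2.3] -/
theorem exists_sub_isBounded (r : IntegralRep n) :
    ∃ A B : IntegralRep (n + 1), Bornology.IsBounded A.domain ∧ Bornology.IsBounded B.domain ∧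
      (∀ z ∈ A.domain, A.integrand z = 1) ∧ (∀ z ∈ B.domain, B.integrand z = 1) ∧
      of r - (of A - of B) ∈ relations := by
  -- the sign pieces
  have hTms : IsSemialgebraic ℚ {x | x ∈ r.domain ∧ r.integrand x < 0} := by
    simpa using r.isSemialgebraicFunOn_integrand.isSemialgebraic_sep_lt
      Literature.ModelTheory.ExponentialFields.tarski_seidenberg_real_holds 0 0
  have hTps : IsSemialgebraic ℚ (r.domain \ {x | x ∈ r.domain ∧ r.integrand x < 0}) :=
    r.isSemialgebraic_domain.diff hTms
  set r₁ := r.restrict _ hTps sdiff_subset with hr₁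
  set r₂ := r.restrict _ hTms (fun x hx => hx.1) with hr₂
  have e1 : of r - of r₁ - of r₂ ∈ relations := by
    refine domainAddRel_subset_relations ⟨n, r, r₁, r₂, ?_, ?_, fun _ _ => rfl, fun _ _ => rfl, rfl⟩
    · rw [hr₁, hr₂, IntegralRep.domain_restrict, IntegralRep.domain_restrict,
        sdiff_union_of_subset fun x hx => hx.1]
    · rw [hr₁, hr₂, IntegralRep.domain_restrict, IntegralRep.domain_restrict,
        show (r.domain \ {x | x ∈ r.domain ∧ r.integrand x < 0}) ∩
          {x | x ∈ r.domain ∧ r.integrand x < 0} = ∅ from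
          Set.disjoint_iff_inter_eq_empty.mp disjoint_sdiff_left, measure_empty]
  have hpos : ∀ x ∈ r₁.domain, 0 ≤ r₁.integrand x := fun x hx => by
    rw [hr₁, IntegralRep.integrand_restrict]
    by_contra h
    exact hx.2 ⟨hx.1, lt_of_not_ge h⟩
  have hneg : ∀ x ∈ r₂.neg.domain, 0 ≤ r₂.neg.integrand x := fun x hx => by
    rw [IntegralRep.integrand_neg, Pi.neg_apply, hr₂, IntegralRep.integrand_restrict, neg_nonneg]
    exact le_of_lt hx.2
  -- under the graphs, then bounded
  obtain ⟨A₀, -, hA₀i, hA₀⟩ := exists_underGraph r₁ hpos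
  obtain ⟨B₀, -, hB₀i, hB₀⟩ := exists_underGraph r₂.neg hneg
  obtain ⟨A, hAb, hAi, eA⟩ := exists_isBounded_sub_mem_relations A₀ fun z _ => by rw [hA₀i]
  obtain ⟨B, hBb, hBi, eB⟩ := exists_isBounded_sub_mem_relations B₀ fun z _ => by rw [hB₀i]
  have e2 : of r₂ + of r₂.neg ∈ relations := levelRel_le_relations (of_add_of_neg_mem_levelRel r₂)
  refine ⟨A, B, hAb, hBb, hAi, hBi, ?_⟩
  have : of r - (of A - of B) = (of r - of r₁ - of r₂) - (of A₀ - of r₁) + (of r₂ + of r₂.neg) +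
      (of B₀ - of r₂.neg) + (of A₀ - of A) - (of B₀ - of B) := by abel
  rw [this]
  exact relations.sub_mem (relations.add_mem (relations.add_mem (relations.add_mem
    (relations.sub_mem e1 (newtonLeibnizRel_subset_relations hA₀)) e2)
    (newtonLeibnizRel_subset_relations hB₀)) eA) eB

/-- **The positive case of Thm. 1.1, unconditionally**: a representation `r` of dimension `d`
with `r.value > 0` differs by relations from `∫_K 1` for a compact `K ⊂ ℝ^{d+1}` with non-empty
interior: `[r] ≡ [A] − [B]` with bounded volumes (`exists_sub_isBounded`), `vol A − vol B =
r.value > 0` by soundness of the moves, and step (d) of the printed proof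
(`exists_isCompact_of_sub_of_sub_mem_relations`, [Viu-Sos 2021, §4]) subtracts.
[cite: ViuSos2021, Thm. 1.1] -/
theorem exists_isCompact_sub_mem_relations_of_value_pos (r : IntegralRep d) (hpos : 0 < r.value) :
    ∃ K : IntegralRep (d + 1), IsCompact K.domain ∧ (interior K.domain).Nonempty ∧
      (∀ z ∈ K.domain, K.integrand z = 1) ∧ of r - of K ∈ relations := by
  obtain ⟨A, B, hAb, hBb, hAi, hBi, e⟩ := exists_sub_isBounded r
  have hlt : B.value < A.value := by
    have h0 := relations_le_ker_eval_holds e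
    rw [AddMonoidHom.mem_ker, map_sub, map_sub, eval_of, eval_of, eval_of] at h0
    linarith
  obtain ⟨K, hKc, hKint, hKi, hK⟩ :=
    exists_isCompact_of_sub_of_sub_mem_relations A B hAb hBb hAi hBi hlt
  refine ⟨K, hKc, hKint, hKi, ?_⟩
  have : of r - of K = (of r - (of A - of B)) + (of A - of B - of K) := by abel
  rw [this]
  exact relations.add_mem e hK

/-- **Viu-Sos' semi-canonical reduction [Viu-Sos 2021, Thm. 1.1], discharged**: *a non-zero
real period `p = ∫_S P/Q` in `ℝ^d` can be rewritten, by the KZ-rules, as `sgn(p) · vol_m(K)` with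
`K ⊂ ℝ^m` a compact top-dimensional semialgebraic set, `0 < m ≤ d + 1`* — here with `m = d + 1`,
by `exists_isCompact_sub_mem_relations_of_value_pos` applied to `r` (`p > 0`) or to `r.neg`
(`p < 0`; `[r] + [r.neg]` is a relation). The proof formalised in the tree follows the print in
its steps (c) [Cor. 2.3: sign split and region under the graph] and (d) [§4: difference of two
volumes by cube counting], and REPLACES its step (b) [Prop. 2.2 / Cor. 2.2: separation of poles
by Hironaka's embedded resolution] by grounding + polynomial box decay + monomial compression
(`KZGroundingRelations.lean`, `DownSetTailDecay.lean`, `KZMonomialCompression.lean`), which also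
makes step (a) [Thm. 2.1: projective compactification] unnecessary; the hypothesis that the
integrand be a quotient of polynomials is not used. [cite: ViuSos2021, Thm. 1.1] -/
theorem semiCanonicalReduction_holds : semiCanonicalReduction := by
  intro d r _ hne
  rcases lt_or_gt_of_ne hne with hneg | hpos
  · have hpos' : 0 < r.neg.value := by
      rw [IntegralRep.value_neg]
      linarith
    obtain ⟨K, hKc, hKint, hKi, hK⟩ := exists_isCompact_sub_mem_relations_of_value_pos r.neg hpos'
    refine ⟨d + 1, K, Nat.succ_pos d, le_rfl, hKc, hKint, hKi, fun h => absurd hneg (lt_asymm h),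
      fun _ => ?_⟩
    have : of r + of K = (of r + of r.neg) - (of r.neg - of K) := by abel
    rw [this]
    exact relations.sub_mem (levelRel_le_relations (of_add_of_neg_mem_levelRel r)) hK
  · obtain ⟨K, hKc, hKint, hKi, hK⟩ := exists_isCompact_sub_mem_relations_of_value_pos r hpos
    exact ⟨d + 1, K, Nat.succ_pos d, le_rfl, hKc, hKint, hKi, fun _ => hK,
      fun h => absurd hpos (lt_asymm h)⟩

/-- **Conjecture 1 ⇔ its volume form [Cresson–Viu-Sos 2022, §1, p. 326], discharged**: the named
fact `kzPeriodConjecture'_iff_volumeConjectureCompact` is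
`kzPeriodConjecture'_iff_volumeConjectureCompact_of_semiCanonicalReduction` applied to the
discharge `semiCanonicalReduction_holds` of [Viu-Sos 2021, Thm. 1.1].
[cite: CressonViusos2022, §1 p. 326] -/
theorem kzPeriodConjecture'_iff_volumeConjectureCompact_holds :
    kzPeriodConjecture'_iff_volumeConjectureCompact :=
  kzPeriodConjecture'_iff_volumeConjectureCompact_of_semiCanonicalReduction semiCanonicalReduction_holds


end KZ

end Literature.NumberTheory.Transcendental
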